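import Summits.Ventures.HodgeRepro2.T6A2WeilRing
import Summits.Ventures.HodgeRepro2.T6A2Gysin

/-!
# T6A2WeilAlg — the algebraic classes of a host Weil cohomology and the `CycleTheory` instance

Cell pub-hodge-repro2, Tier 6 (README §10), seat t6-p2 (A2 host side). On the even-degree ring
`EvenRing W P` of `T6A2WeilRing`: the subalgebra `algSub W P` spanned by the host's rational algebraic classes
`W.ratAlgebraicClasses P.X p` (closed under the cup product by `cup_mem_ratAlgebraicClasses`, unital by
`cycleClass_of_coheight_eq_zero` at the generic point, stable under pull-back by
`pullback_ratAlgebraicClasses_le`), and **`cycleTheory W S hpush : T6A2Gysin.CycleTheory`** — A2's data-only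
carrier instantiated on a family `S : ι → SPVar k` of smooth projective varieties: `H := EvenRing`, `Hom := H`,
`cap := (·  *  ·)`, `mu := 1` (so `PD = id`), `aug := integral` (the trace), `pull`, `pushHom := push` (the adjoint
Gysin map), `Cyc := algSub`, `cl := the inclusion`. The seven displayed facts of `T6A2Gysin` become THEOREMS
(`cycleTheory_hypotheses`): functoriality, the cup product, the cap product with the projection formula,
the naturality of the integral, Poincaré duality, the compatibility of `cl` with push-forward, and the ring
homomorphism property of `cl` — all from the host's `WeilCohomology` fields, given ONE input `hpush` (the push-forward
of an algebraic class is algebraic: the host's correspondence axiom `map_ratAlgebraicClasses_of_isInducedBy`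
applied to the transposed graph class, or Fulton p. 371 as a display). No `sorry`; standard axioms.
§8(d): uses an L-value-free non-vanishing device: NO.
-/

noncomputable section

namespace Summit.Ventures.HodgeRepro2.T6.WeilInst

open HostAPI.Carriers.AlgebraicGeometry.Motives CategoryTheory Opposite
open Summit.Ventures.HodgeRepro2.T6.A2Gysin
open scoped DirectSum Pointwise

universe u

variable {k : Type u} [Field k] (W : WeilCohomology k ℚ) (P : SPVar k)

/-- the homogeneous rational algebraic classes, placed in the even-degree ring -/
def algSet : Set (EvenRing W P) :=
  ⋃ p, ofDeg W P p '' (W.ratAlgebraicClasses P.X p : Set (Ev W P.X p))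

/-- a homogeneous rational algebraic class is in `algSet` -/
theorem ofDeg_mem_algSet {p : ℕ} {a : Ev W P.X p} (ha : a ∈ W.ratAlgebraicClasses P.X p) :
    ofDeg W P p a ∈ algSet W P :=
  Set.mem_iUnion.2 ⟨p, ⟨a, ha, rfl⟩⟩

/-- `algSet` is closed under products (`cup_mem_ratAlgebraicClasses`) -/
theorem algSet_mul_subset : algSet W P * algSet W P ⊆ algSet W P := by
  rintro _ ⟨x, hx, y, hy, rfl⟩
  obtain ⟨p, a, ha, rfl⟩ := Set.mem_iUnion.1 hx
  obtain ⟨q, b, hb, rfl⟩ := Set.mem_iUnion.1 hy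
  show ofDeg W P p a * ofDeg W P q b ∈ algSet W P
  rw [ofDeg_mul_ofDeg]
  exact ofDeg_mem_algSet W P (W.cup_mem_ratAlgebraicClasses P.smooth rfl a b ha hb)

/-- `X` has a generic point: a point of coheight `0` (`X` non-empty; in the cell's use `X` is integral) -/
def HasGen : Prop := ∃ z : P.X.left, Order.coheight z = 0

/-- `1` is the class of the generic point -/
theorem one_mem_algSet (hgen : HasGen P) : (1 : EvenRing W P) ∈ algSet W P := by
  obtain ⟨z, hz⟩ := hgen
  rw [one_def, ← W.cycleClass_of_coheight_eq_zero P.smooth z hz]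
  exact ofDeg_mem_algSet W P
    (W.algebraicLattice_le_ratAlgebraicClasses P.X 0 (W.cycleClass_mem_algebraicLattice P.X 0 hz))

/-- THE ALGEBRAIC CLASSES `A^*(X)_ℚ ⊂ H^{even}(X, ℚ)`: the `ℚ`-subalgebra spanned by the cycle classes. -/
def algSub (hgen : HasGen P) : Subalgebra ℚ (EvenRing W P) where
  carrier := Submodule.span ℚ (algSet W P)
  mul_mem' {x y} hx hy := by
    have := Submodule.mul_mem_mul hx hy
    rw [Submodule.span_mul_span] at this
    exact Submodule.span_mono (algSet_mul_subset W P) this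
  one_mem' := Submodule.subset_span (one_mem_algSet W P hgen)
  add_mem' {x y} hx hy := Submodule.add_mem _ hx hy
  zero_mem' := Submodule.zero_mem _
  algebraMap_mem' r := by
    rw [Algebra.algebraMap_eq_smul_one]
    exact Submodule.smul_mem _ r (Submodule.subset_span (one_mem_algSet W P hgen))

/-- membership in `algSub`, unfolded -/
theorem mem_algSub_iff (hgen : HasGen P) (x : EvenRing W P) :
    x ∈ algSub W P hgen ↔ x ∈ Submodule.span ℚ (algSet W P) := Iff.rfl

/-- a homogeneous rational algebraic class is in `algSub` -/
theorem ofDeg_mem_algSub (hgen : HasGen P) {p : ℕ} {a : Ev W P.X p} (ha : a ∈ W.ratAlgebraicClasses P.X p) :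
    ofDeg W P p a ∈ algSub W P hgen :=
  Submodule.subset_span (ofDeg_mem_algSet W P ha)

section pullAlg

variable {P} {Q : SPVar k} (g : P.X ⟶ Q.X)

/-- pull-backs of algebraic classes are algebraic (`pullback_ratAlgebraicClasses_le`) -/
theorem pull_mem_algSub (hP : HasGen P) (hQ : HasGen Q) {x : EvenRing W Q} (hx : x ∈ algSub W Q hQ) :
    pull W g x ∈ algSub W P hP := by
  rw [mem_algSub_iff] at hx ⊢
  refine Submodule.span_induction ?_ ?_ ?_ ?_ hx
  · intro y hy
    obtain ⟨p, a, ha, rfl⟩ := Set.mem_iUnion.1 hy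
    rw [pull_ofDeg]
    refine Submodule.subset_span (ofDeg_mem_algSet W P ?_)
    exact W.pullback_ratAlgebraicClasses_le P.smooth Q.smooth g p ⟨a, ha, rfl⟩
  · simp
  · intro y z _ _ hy hz
    rw [map_add]; exact Submodule.add_mem _ hy hz
  · intro r y _ hy
    rw [map_smul]; exact Submodule.smul_mem _ r hy

end pullAlg

section instance_

variable {ι : Type u} (S : ι → SPVar k) (hgen : ∀ a, HasGen (S a))

/-- the push-forward of an algebraic class is algebraic (the one input of the instantiation; the host's
`map_ratAlgebraicClasses_of_isInducedBy` on the transposed graph class, or Fulton p. 371 as a display) -/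
def PushAlg : Prop :=
  ∀ {a b : ι} (g : (S a).X ⟶ (S b).X), ∀ x ∈ algSub W (S a) (hgen a), push W g x ∈ algSub W (S b) (hgen b)

variable (hpush : PushAlg W S hgen)

/-- A2's `CycleTheory` ON THE HOST WEIL COHOMOLOGY. -/
def cycleTheory : CycleTheory.{u} where
  Space := ι
  Mor a b := (S a).X ⟶ (S b).X
  id _ := 𝟙 _
  comp g f := f ≫ g
  H a := EvenRing W (S a)
  Hom a := EvenRing W (S a)
  cap a := LinearMap.mul ℚ (EvenRing W (S a))
  pull g := (pull W g).toLinearMap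
  pushHom g := push W g
  mu _ := 1
  aug a := integral W (S a)
  Cyc a := algSub W (S a) (hgen a)
  cl a := (algSub W (S a) (hgen a)).val.toLinearMap
  cycPush g := (push W g).restrict fun x hx => hpush g x hx
  cycPull g := (pull W g).toLinearMap.restrict fun _ hx => pull_mem_algSub W g (hgen _) (hgen _) hx

/-- THE SEVEN DISPLAYED FACTS OF `T6A2Gysin` HOLD ON THE HOST WEIL COHOMOLOGY. -/
theorem cycleTheory_hypotheses :
    (cycleTheory W S hgen hpush).Functoriality ∧ (cycleTheory W S hgen hpush).BredonCupProduct ∧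
      (cycleTheory W S hgen hpush).BredonCapProduct ∧ (cycleTheory W S hgen hpush).AugmentationNatural ∧
      (cycleTheory W S hgen hpush).PoincareDuality ∧ (cycleTheory W S hgen hpush).FultonProperPushForward ∧
      (cycleTheory W S hgen hpush).FultonCycleClassRingHom := by
  refine ⟨⟨?_, ?_, ?_, ?_⟩, ?_, ⟨?_, ?_, ?_⟩, ?_, ?_, ?_, ⟨?_, ?_, ?_⟩⟩
  · intro a; exact LinearMap.ext fun x => push_id W x
  · intro a b c g f; exact LinearMap.ext fun x => push_comp W f g x
  · intro a; exact LinearMap.ext fun x => pull_id W x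
  · intro a b c g f; exact LinearMap.ext fun x => pull_comp W f g x
  · intro a b g
    exact ⟨fun x y => map_mul (pull W g) x y, map_one (pull W g)⟩
  · intro a (γ : EvenRing W (S a))
    exact one_mul γ
  · intro a (α : EvenRing W (S a)) (β : EvenRing W (S a)) (γ : EvenRing W (S a))
    exact mul_assoc α β γ
  · intro a b g (α : EvenRing W (S b)) (β : EvenRing W (S a))
    exact push_pull_mul W g α β
  · intro a b g; exact LinearMap.ext fun x => integral_push W g x
  · intro a
    have h : ∀ x : EvenRing W (S a), (cycleTheory W S hgen hpush).PD a x = x := fun x => mul_one x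
    exact Function.bijective_iff_has_inverse.2 ⟨id, fun x => h x, fun x => h x⟩
  · intro a b (g : (S a).X ⟶ (S b).X) (y : algSub W (S a) (hgen a))
    change push W g ((y : EvenRing W (S a)) * 1) = push W g (y : EvenRing W (S a)) * 1
    rw [mul_one, mul_one]
  · intro a; rfl
  · intro a x y; rfl
  · intro a b g x; rfl

end instance_

end Summit.Ventures.HodgeRepro2.T6.WeilInst

end
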